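import Mathlib
import Summits.ValiantsHypothesis.ValiantsHypothesis.Theorems.BarrierLeverPartitionMinorsHitByVPHiddenStatesFullJoinGeneric
import Summits.ValiantsHypothesis.ValiantsHypothesis.Theorems.BarrierLeverPartitionMinorsHitByVPHiddenStatesFullJoinLeaf

/-!
# Route BarrierLever — item `PartitionMinorsHitByVP` (stmt-ValiantsHypothesis-19717), line `hidden_states`:
# A WORKED INSTANCE OF THE FULL-JOIN TOOLKIT — a non-isomorphic pair settled by one equal-link step and two star leaves

Helper file (`--supports stmt-ValiantsHypothesis-19717`; cell valiant-natproofs, rung V4, 𝒟-side door (c), line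
`Cruxes/PartitionMinorsHitByVP/Lines/hidden_states.lean` v8; prover seat val-np-p3 gen 16). Definition-free. Closes NO item.

THE POINT (memo val-np-p3 g16 «full join» §9). End-to-end check that the kernel toolkit composes: at `h = 4` the lower pair
`𝒰 = B₁(4) ∪ {01, 02}` (a 2-star), `𝒲 = B₁(4) ∪ {01, 23}` (a 2-matching) — `r = 7`, NOT isomorphic — has a nonsingular one-cube full hidden
sum with `K = 5` states (`fullJoin_example_star_matching`): cut `𝒰` at coordinate `1` and `𝒲` at coordinate `3` (deletion parts of size 5,
link parts of size 2 — EQUAL), apply `fullJoinCube_step'` (p675575), and close both children by the star leaf `fullJoinCube_of_le`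
(p675793; `5 ≤ 4 + 1`, `2 ≤ 4 + 1`). All side conditions are decided by `decide`.

WHAT THIS IS NOT: one instance; item 19717 stays OPEN; nothing on crux 14610 or VP ≠ VNP.
-/

set_option linter.dupNamespace false

namespace Summit.ValiantsHypothesis.ValiantsHypothesis.Theorems.BarrierLever.HiddenStates

open Finset Matrix

noncomputable section

namespace FullJoin

/-- **Worked instance.** The pair (2-star, 2-matching) over `B₁(4)` at `h = 4`, `r = 7`: rows
`u = (∅, {0}, {2}, {3}, {0,2}, {1}, {0,1})`, columns `w = (∅, {0}, {1}, {2}, {0,1}, {3}, {2,3})`; a `5`-state one-cube full hidden sum is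
nonsingular. -/
theorem fullJoin_example_star_matching :
    ∃ (tx ty : Option (Fin 5) → Fin 4 → ℂ) (lam : Fin 5 → ℂ),
      (Matrix.of fun i j : Fin 7 => ∑ J : Finset (Fin 5), (∏ q ∈ J, lam q) *
        ((∏ a ∈ (![∅, {0}, {2}, {3}, {0, 2}, {1}, {0, 1}] : Fin 7 → Finset (Fin 4)) i,
            (tx none a + ∑ q ∈ J, tx (some q) a)) *
          ∏ c ∈ (![∅, {0}, {1}, {2}, {0, 1}, {3}, {2, 3}] : Fin 7 → Finset (Fin 4)) j,
            (ty none c + ∑ q ∈ J, ty (some q) c))).det ≠ 0 := by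
  refine fullJoinCube_step' (K := 4) (rD := 5) (rL := 2)
    (![∅, {0}, {2}, {3}, {0, 2}, {1}, {0, 1}] : Fin 7 → Finset (Fin 4))
    (![∅, {0}, {1}, {2}, {0, 1}, {3}, {2, 3}] : Fin 7 → Finset (Fin 4))
    (1 : Fin 4) (3 : Fin 4) finSumFinEquiv finSumFinEquiv ?_ ?_ ?_ ?_ ![0, 1] ?_ ?_ ?_
  · decide
  · decide
  · decide
  · decide
  · decide
  · -- deletion pair: 5 rows ≤ 4 + 1 states — star leaf
    exact fullJoinCube_of_le _ _ (by decide) (by decide) (by norm_num)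
  · -- link pair: 2 rows — star leaf
    exact fullJoinCube_of_le _ _ (by decide) (by decide) (by norm_num)

end FullJoin

end

end Summit.ValiantsHypothesis.ValiantsHypothesis.Theorems.BarrierLever.HiddenStates
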